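import Literature.NumberTheory.EllipticCurves.PAdicTwoVariableTransform
import HarnessLib

/-!
# The two-variable Amice transform with values in a complete non-archimedean field over `ℚ_p`,
# and its values at the CONTINUOUS CHARACTERS of `ℤ_p²`

For a bounded distribution `μ` on `ℤ_p × ℤ_p = lim (ℤ/pⁿ)²` (`BoundedDistribution (padicIntSq p) 𝕜`,
`PAdicDistributionIntegral.lean`) with values in ANY complete non-archimedean normed field `𝕜` over
`ℚ_p` — the case of interest being `𝕜 = ℂ_p`, where the two-variable `p`-adic `L`-functions of CM
fields take their values (Katz 1978, Yager 1982, de Shalit 1987 II.4.17: the measure has values in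
`𝐃 = 𝒪(\widehat{ℚ_p^{ur}}) ⊆ 𝒪_{ℂ_p}`, an INFINITE extension of `ℤ_p`, so the tree's `ℚ_p`-valued
engine `PAdicTwoVariableTransform.lean` and its finite-dimensional bootstrap
`PAdicMeasureTransformAlgCl.lean` do not apply) — we define the nested two-variable Amice transform

  `𝓐_μ(T₁, T₂) = Σ_{i,j} (∫ (x choose i)(y choose j) dμ(x, y)) T₁^i T₂^j ∈ 𝕜⟦T₂⟧⟦T₁⟧`

(`BoundedDistribution.amice₂`, outer variable `T₁` ↔ first coordinate) and prove the **character
evaluation theorem** (`BoundedDistribution.hasSum_amice₂_character`): for every CONTINUOUS CHARACTER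
`F : ℤ_p² → 𝕜` (`F(z + w) = F(z)F(w)`) whose values at the basis vectors are principal units
(`‖F(1,0) − 1‖ < 1`, `‖F(0,1) − 1‖ < 1`),

  `Σ_{i,j} [T₁^iT₂^j]𝓐_μ · (F(1,0) − 1)^i (F(0,1) − 1)^j = ∫ F dμ`      (a `HasSum` over `ℕ × ℕ`).

This is the sentence "we leave it to the reader to define `G(χ; T₁, T₂)` as a power series in two
variables … and to derive the analogues of (52) and (53)" of de Shalit 1987, II.4.17 (p. 78):
(53) `G(χ₀; T) = Σ χ₀⁻¹(τ) ∫ (1+T)^a dμ` is the Amice transform and (52) `L_{p,𝔣}(χκ^{−s}) =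
G(χ₀; χ₁(γ₀)⁻¹u^s − 1)` is its value at the character `a ↦ (χ₁(γ₀)⁻¹u^s)^a` of `ℤ_p`; here in two
variables and for an ARBITRARY continuous character (not only `p`-adic powers `u^s`, `u ∈ ℤ_p`: the
avatars of Hecke characters of type `(k, j)` take values in ramified extensions of `ℚ_p`).

The proof needs no Mahler expansion theorem: at NATURAL points `(a, b)` the character is
`F(1,0)^a F(0,1)^b = (1 + u)^a (1 + v)^b` and the binomial theorem gives the box truncation error
`≤ max(‖u‖, ‖v‖)^N` (ultrametric inequality); both sides are continuous, `ℕ²` is dense in `ℤ_p²`, so the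
bound holds everywhere; integrate (`‖∫‖ ≤ ‖μ‖ · sup`) and let `N → ∞`; the defining family is summable
by comparison with a double geometric series.

## Main definitions and results (all proved; no named fact)

* `padicIntCast 𝕜 : ℤ_[p] →+* 𝕜` — the structure map, an isometry (`norm_padicIntCast`).
* `mahlerFun₂ 𝕜 i j : ℤ_p × ℤ_p → 𝕜`, `(x, y) ↦ (x choose i)(y choose j)`; continuity, norm `≤ 1`,
  values at natural points.
* `IsContinuousChar₂ F` — `F : ℤ_p × ℤ_p → 𝕜` is a continuous character with principal-unit values at
  the basis; `IsContinuousChar₂.apply_natCast` (`F(a, b) = F(1,0)^a F(0,1)^b`),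
  `IsContinuousChar₂.norm_sub_boxSum_le` (the uniform box-truncation bound).
* `BoundedDistribution.amice₂ D : PowerSeries (PowerSeries 𝕜)` — the transform; `coeff_coeff_amice₂`,
  `norm_coeff_coeff_amice₂_le`.
* `BoundedDistribution.hasSum_amice₂_character` — **the character evaluation theorem**.

## References

* [deShalit1987] E. de Shalit, *Iwasawa theory of elliptic curves with complex multiplication*,
  Perspectives in Math. 3, Academic Press 1987, II.4.17 (52)–(54) (p. 77–78); I.3.1–3.4 (p. 13–15:
  measures on `ℤ_p` with values in `𝐃` and their power series).
* [MazurTateTeitelbaum1986Invent] B. Mazur, J. Tate, J. Teitelbaum, Invent. Math. 84 (1986), §I.11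
  (measures and integrals), §I.13.
* [Washington1997] L. C. Washington, *Introduction to Cyclotomic Fields*, GTM 83, §12.2 (measures and
  power series), §7.2.
-/

noncomputable section

open Filter Topology

namespace Literature.NumberTheory.EllipticCurves

variable {p : ℕ} [Fact p.Prime]

/-! ### §1. The structure map `ℤ_p → 𝕜` and the two-variable binomial functions -/

section Cast

variable (𝕜 : Type*) [NormedField 𝕜] [NormedAlgebra ℚ_[p] 𝕜]

/-- **The structure map `ℤ_p → 𝕜`** of a normed field over `ℚ_p` (`ℤ_p ⊆ ℚ_p → 𝕜`), through which the
`ℤ_p`-valued binomial functions `x ↦ (x choose i)` are read in `𝕜` (de Shalit I.3.1: "`𝐃`-valued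
measures", `ℤ_p ⊆ 𝐃`). [cite: deShalit1987, I.3.1 (p. 13)] -/
def padicIntCast : ℤ_[p] →+* 𝕜 := (algebraMap ℚ_[p] 𝕜).comp PadicInt.Coe.ringHom

variable {𝕜}

/-- Unfolding lemma: `padicIntCast 𝕜 z = algebraMap ℚ_p 𝕜 z`. [cite: deShalit1987, I.3.1 (p. 13)] -/
theorem padicIntCast_apply (z : ℤ_[p]) : padicIntCast 𝕜 z = algebraMap ℚ_[p] 𝕜 (z : ℚ_[p]) := rfl

/-- The structure map is an ISOMETRY: `‖z‖_𝕜 = ‖z‖_p`. [cite: deShalit1987, I.3.1 (p. 13)] -/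
theorem norm_padicIntCast (z : ℤ_[p]) : ‖padicIntCast 𝕜 z‖ = ‖z‖ := by
  rw [padicIntCast_apply, norm_algebraMap', PadicInt.padic_norm_e_of_padicInt]

/-- In particular `‖padicIntCast 𝕜 z‖ ≤ 1`. [cite: deShalit1987, I.3.1 (p. 13)] -/
theorem norm_padicIntCast_le_one (z : ℤ_[p]) : ‖padicIntCast 𝕜 z‖ ≤ 1 := by
  rw [norm_padicIntCast]; exact PadicInt.norm_le_one z

/-- The structure map is continuous. [cite: deShalit1987, I.3.1 (p. 13)] -/
theorem continuous_padicIntCast : Continuous (padicIntCast (p := p) 𝕜) :=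
  (algebraMapCLM ℚ_[p] 𝕜).continuous.comp continuous_subtype_val

/-- Natural numbers go to natural numbers. [cite: deShalit1987, I.3.1 (p. 13)] -/
theorem padicIntCast_natCast (n : ℕ) : padicIntCast 𝕜 (n : ℤ_[p]) = (n : 𝕜) := map_natCast _ n

variable (𝕜)

/-- **The two-variable binomial (Mahler) function** `(x, y) ↦ (x choose i)·(y choose j)` on `ℤ_p × ℤ_p`,
read in `𝕜` (the coefficient functional of `T₁^i T₂^j` in `∫ (1+T₁)^x (1+T₂)^y dμ`).
[cite: deShalit1987, II.4.17 (53) (p. 77)] -/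
def mahlerFun₂ (i j : ℕ) : ℤ_[p] × ℤ_[p] → 𝕜 := fun z ↦ padicIntCast 𝕜 (mahler i z.1 * mahler j z.2)

variable {𝕜}

/-- Unfolding lemma for `mahlerFun₂`. [cite: deShalit1987, II.4.17 (53) (p. 77)] -/
theorem mahlerFun₂_apply (i j : ℕ) (z : ℤ_[p] × ℤ_[p]) :
    mahlerFun₂ 𝕜 i j z = padicIntCast 𝕜 (mahler i z.1 * mahler j z.2) := rfl

/-- The binomial functions are continuous. [cite: deShalit1987, II.4.17 (53) (p. 77)] -/
theorem continuous_mahlerFun₂ (i j : ℕ) : Continuous (mahlerFun₂ (p := p) 𝕜 i j) :=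
  continuous_padicIntCast.comp
    (((mahler i).continuous.comp continuous_fst).mul ((mahler j).continuous.comp continuous_snd))

/-- The binomial functions are uniformly continuous (`ℤ_p × ℤ_p` is compact).
[cite: deShalit1987, II.4.17 (53) (p. 77)] -/
theorem uniformContinuous_mahlerFun₂ (i j : ℕ) : UniformContinuous (mahlerFun₂ (p := p) 𝕜 i j) :=
  CompactSpace.uniformContinuous_of_continuous (continuous_mahlerFun₂ i j)

/-- The binomial functions take values of norm `≤ 1`. [cite: deShalit1987, II.4.17 (53) (p. 77)] -/
theorem norm_mahlerFun₂_le_one (i j : ℕ) (z : ℤ_[p] × ℤ_[p]) : ‖mahlerFun₂ 𝕜 i j z‖ ≤ 1 := by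
  rw [mahlerFun₂_apply]; exact norm_padicIntCast_le_one _

/-- At a natural point `(a, b)` the binomial function is `(a choose i)·(b choose j)`.
[cite: deShalit1987, II.4.17 (53) (p. 77)] -/
theorem mahlerFun₂_natCast (i j a b : ℕ) :
    mahlerFun₂ 𝕜 i j ((a : ℤ_[p]), (b : ℤ_[p])) = ((a.choose i : ℕ) : 𝕜) * ((b.choose j : ℕ) : 𝕜) := by
  rw [mahlerFun₂_apply, mahler_natCast_eq, mahler_natCast_eq, map_mul, padicIntCast_natCast,
    padicIntCast_natCast]

end Cast

section MulConst

variable {𝕜 : Type*} [NormedField 𝕜]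

/-- A function times a constant is uniformly continuous if the function is (in a normed field).
[cite: MazurTateTeitelbaum1986Invent, §I.11] -/
theorem uniformContinuous_mul_const {X : Type*} [UniformSpace X] {f : X → 𝕜}
    (hf : UniformContinuous f) (c : 𝕜) : UniformContinuous fun x ↦ f x * c := by
  have h := (uniformContinuous_const_smul (M := 𝕜) c).comp hf
  simpa only [Function.comp_def, smul_eq_mul, mul_comm] using h

end MulConst

/-! ### §2. Continuous characters of `ℤ_p²` with principal-unit values, and the box truncations -/

section Character

variable {𝕜 : Type*} [NormedField 𝕜]

/-- **A continuous character of `ℤ_p × ℤ_p` with values in `𝕜` and principal-unit values at the basis**: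
`F` continuous, `F(z + w) = F(z)F(w)`, `‖F(1,0) − 1‖ < 1`, `‖F(0,1) − 1‖ < 1` — e.g. the `p`-adic avatar
of a Hecke character of a `ℤ_p²`-extension read in coordinates (de Shalit II.4.17: the characters
`χκ₁^{−s₁}κ₂^{−s₂}` of `Gal(K_∞K'_∞/K) ≅ ℤ_p²`). [cite: deShalit1987, II.4.17 (54) (p. 78)] -/
structure IsContinuousChar₂ (F : ℤ_[p] × ℤ_[p] → 𝕜) : Prop where
  /-- continuity -/
  continuous : Continuous F
  /-- multiplicativity (a character of the additive group `ℤ_p²`) -/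
  map_add : ∀ z w, F (z + w) = F z * F w
  /-- the value at `(1, 0)` is a principal unit -/
  norm_fst_sub_one_lt : ‖F (1, 0) - 1‖ < 1
  /-- the value at `(0, 1)` is a principal unit -/
  norm_snd_sub_one_lt : ‖F (0, 1) - 1‖ < 1

namespace IsContinuousChar₂

variable {F : ℤ_[p] × ℤ_[p] → 𝕜}

/-- A character takes the value `1` at `0` (it is `0` or `1`, and `F ≡ 0` contradicts
`‖F(1,0) − 1‖ < 1`). [cite: deShalit1987, II.4.17 (54) (p. 78)] -/
theorem map_zero (hF : IsContinuousChar₂ F) : F 0 = 1 := by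
  have h0 : F 0 * (F 0 - 1) = 0 := by
    have := hF.map_add 0 0
    rw [add_zero] at this
    rw [mul_sub, mul_one, ← this, sub_self]
  rcases mul_eq_zero.mp h0 with h | h
  · exfalso
    have h1 : F (1, 0) = 0 := by
      have := hF.map_add (1, 0) 0
      rw [add_zero] at this
      rw [this, h, mul_zero]
    have := hF.norm_fst_sub_one_lt
    rw [h1, zero_sub, norm_neg, norm_one] at this
    exact lt_irrefl _ this
  · exact sub_eq_zero.mp h

/-- `F(n • z) = F(z)^n`. [cite: deShalit1987, II.4.17 (54) (p. 78)] -/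
theorem map_nsmul (hF : IsContinuousChar₂ F) (n : ℕ) (z : ℤ_[p] × ℤ_[p]) : F (n • z) = F z ^ n := by
  induction n with
  | zero => rw [zero_smul, pow_zero, hF.map_zero]
  | succ n ih => rw [succ_nsmul, hF.map_add, ih, pow_succ]

/-- **At natural points a character is a product of powers**: `F(a, b) = F(1,0)^a · F(0,1)^b`.
[cite: deShalit1987, II.4.17 (54) (p. 78)] -/
theorem apply_natCast (hF : IsContinuousChar₂ F) (a b : ℕ) :
    F ((a : ℤ_[p]), (b : ℤ_[p])) = F (1, 0) ^ a * F (0, 1) ^ b := by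
  have h : ((a : ℤ_[p]), (b : ℤ_[p])) = a • ((1 : ℤ_[p]), (0 : ℤ_[p])) + b • ((0 : ℤ_[p]), (1 : ℤ_[p])) := by
    ext <;> simp
  rw [h, hF.map_add, hF.map_nsmul, hF.map_nsmul]

/-- The character is uniformly continuous (`ℤ_p²` is compact). [cite: deShalit1987, II.4.17 (54) (p. 78)] -/
theorem uniformContinuous (hF : IsContinuousChar₂ F) : UniformContinuous F :=
  CompactSpace.uniformContinuous_of_continuous hF.continuous

end IsContinuousChar₂

variable [IsUltrametricDist 𝕜]

/-- **One-variable binomial tail bound** in an ultrametric field: for `‖u‖ ≤ 1` and natural `a`,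
`‖(1 + u)^a − Σ_{i<N} (a choose i) u^i‖ ≤ ‖u‖^N` (the omitted terms `(a choose i)u^i`, `N ≤ i ≤ a`, have
norm `≤ ‖u‖^N`). [cite: Washington1997, §7.2] -/
theorem norm_one_add_pow_sub_sum_range_le {u : 𝕜} (hu : ‖u‖ ≤ 1) (a N : ℕ) :
    ‖(1 + u) ^ a - ∑ i ∈ Finset.range N, ((a.choose i : ℕ) : 𝕜) * u ^ i‖ ≤ ‖u‖ ^ N := by
  -- the full binomial expansion, written over `range M` for any `M > a`
  set M := max (a + 1) N with hM
  have hfull : (1 + u) ^ a = ∑ i ∈ Finset.range M, ((a.choose i : ℕ) : 𝕜) * u ^ i := by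
    rw [add_comm, add_pow]
    have hsub : Finset.range (a + 1) ⊆ Finset.range M := Finset.range_mono (le_max_left _ _)
    rw [← Finset.sum_subset hsub]
    · refine Finset.sum_congr rfl fun i _ ↦ ?_
      rw [one_pow, mul_one, mul_comm]
    · intro i hi hi'
      have hai : a < i := by
        simp only [Finset.mem_range, not_lt] at hi hi'
        omega
      rw [Nat.choose_eq_zero_of_lt hai, Nat.cast_zero, zero_mul]
  have hNM : N ≤ M := le_max_right _ _
  rw [hfull, ← Finset.sum_range_add_sum_Ico _ hNM, add_sub_cancel_left]
  refine IsUltrametricDist.norm_sum_le_of_forall_le_of_nonneg (pow_nonneg (norm_nonneg u) N)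
    fun i hi ↦ ?_
  rw [Finset.mem_Ico] at hi
  rw [norm_mul, norm_pow]
  calc ‖((a.choose i : ℕ) : 𝕜)‖ * ‖u‖ ^ i ≤ 1 * ‖u‖ ^ N :=
        mul_le_mul (IsUltrametricDist.norm_natCast_le_one 𝕜 _)
          (pow_le_pow_of_le_one (norm_nonneg u) hu hi.1) (pow_nonneg (norm_nonneg u) i) zero_le_one
    _ = ‖u‖ ^ N := one_mul _

/-- A truncated binomial sum has norm `≤ 1` (for `‖u‖ ≤ 1`). [cite: Washington1997, §7.2] -/
theorem norm_sum_range_choose_mul_pow_le_one {u : 𝕜} (hu : ‖u‖ ≤ 1) (a N : ℕ) :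
    ‖∑ i ∈ Finset.range N, ((a.choose i : ℕ) : 𝕜) * u ^ i‖ ≤ 1 := by
  refine IsUltrametricDist.norm_sum_le_of_forall_le_of_nonneg zero_le_one fun i _ ↦ ?_
  rw [norm_mul, norm_pow]
  calc ‖((a.choose i : ℕ) : 𝕜)‖ * ‖u‖ ^ i ≤ 1 * 1 := by
        gcongr
        · exact IsUltrametricDist.norm_natCast_le_one 𝕜 _
        · exact pow_le_one₀ (norm_nonneg u) hu
    _ = 1 := one_mul _

/-- `‖1 + u‖ ≤ 1` for `‖u‖ ≤ 1`, hence `‖(1 + u)^a‖ ≤ 1`. [cite: Washington1997, §7.2] -/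
theorem norm_one_add_pow_le_one {u : 𝕜} (hu : ‖u‖ ≤ 1) (a : ℕ) : ‖(1 + u) ^ a‖ ≤ 1 := by
  rw [norm_pow]
  refine pow_le_one₀ (norm_nonneg _) ?_
  calc ‖1 + u‖ ≤ max ‖(1 : 𝕜)‖ ‖u‖ := IsUltrametricDist.norm_add_le_max _ _
    _ ≤ 1 := max_le (by rw [norm_one]) hu

variable [NormedAlgebra ℚ_[p] 𝕜]

variable (𝕜) in
/-- **The box truncation** `S_N(u, v)(x, y) = Σ_{i,j<N} (x choose i)(y choose j) u^i v^j` of the kernel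
`(1+u)^x (1+v)^y`, as a function on `ℤ_p × ℤ_p`. [cite: deShalit1987, II.4.17 (53) (p. 77)] -/
def boxSum (u v : 𝕜) (N : ℕ) : ℤ_[p] × ℤ_[p] → 𝕜 := fun z ↦
  ∑ ij ∈ Finset.range N ×ˢ Finset.range N, mahlerFun₂ 𝕜 ij.1 ij.2 z * (u ^ ij.1 * v ^ ij.2)

omit [IsUltrametricDist 𝕜] in
/-- Unfolding lemma for `boxSum`. [cite: deShalit1987, II.4.17 (53) (p. 77)] -/
theorem boxSum_apply (u v : 𝕜) (N : ℕ) (z : ℤ_[p] × ℤ_[p]) :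
    boxSum 𝕜 u v N z =
      ∑ ij ∈ Finset.range N ×ˢ Finset.range N, mahlerFun₂ 𝕜 ij.1 ij.2 z * (u ^ ij.1 * v ^ ij.2) := rfl

omit [IsUltrametricDist 𝕜] in
/-- The box truncation is uniformly continuous. [cite: deShalit1987, II.4.17 (53) (p. 77)] -/
theorem uniformContinuous_boxSum (u v : 𝕜) (N : ℕ) : UniformContinuous (boxSum (p := p) 𝕜 u v N) :=
  uniformContinuous_finset_sum _ fun ij _ ↦ uniformContinuous_mul_const (uniformContinuous_mahlerFun₂ ij.1 ij.2) _

omit [IsUltrametricDist 𝕜] in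
/-- The box truncation is continuous. [cite: deShalit1987, II.4.17 (53) (p. 77)] -/
theorem continuous_boxSum (u v : 𝕜) (N : ℕ) : Continuous (boxSum (p := p) 𝕜 u v N) :=
  (uniformContinuous_boxSum u v N).continuous

omit [IsUltrametricDist 𝕜] in
/-- **At a natural point the box truncation is the product of the truncated binomial sums**:
`S_N(a, b) = (Σ_{i<N} (a choose i) u^i)(Σ_{j<N} (b choose j) v^j)`. [cite: deShalit1987, II.4.17 (53) (p. 77)] -/
theorem boxSum_natCast (u v : 𝕜) (N a b : ℕ) :
    boxSum 𝕜 u v N ((a : ℤ_[p]), (b : ℤ_[p])) =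
      (∑ i ∈ Finset.range N, ((a.choose i : ℕ) : 𝕜) * u ^ i) *
        ∑ j ∈ Finset.range N, ((b.choose j : ℕ) : 𝕜) * v ^ j := by
  rw [boxSum_apply, Finset.sum_mul_sum, Finset.sum_product]
  refine Finset.sum_congr rfl fun i _ ↦ Finset.sum_congr rfl fun j _ ↦ ?_
  rw [mahlerFun₂_natCast]
  ring

/-- **Uniform approximation of a character by the box truncations**: for a continuous character `F`
with `u = F(1,0) − 1`, `v = F(0,1) − 1` principal-unit parameters,
`‖F(z) − S_N(u, v)(z)‖ ≤ max(‖u‖, ‖v‖)^N` for EVERY `z ∈ ℤ_p²` — at natural points by the binomial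
theorem (`F(a,b) = (1+u)^a(1+v)^b`), everywhere by continuity and density of `ℕ²`.
[cite: deShalit1987, II.4.17 (52)–(54) (p. 77–78)] -/
theorem IsContinuousChar₂.norm_sub_boxSum_le {F : ℤ_[p] × ℤ_[p] → 𝕜} (hF : IsContinuousChar₂ F)
    (N : ℕ) (z : ℤ_[p] × ℤ_[p]) :
    ‖F z - boxSum 𝕜 (F (1, 0) - 1) (F (0, 1) - 1) N z‖ ≤
      (max ‖F (1, 0) - 1‖ ‖F (0, 1) - 1‖) ^ N := by
  set u := F (1, 0) - 1 with hu
  set v := F (0, 1) - 1 with hv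
  have hu1 : ‖u‖ ≤ 1 := hF.norm_fst_sub_one_lt.le
  have hv1 : ‖v‖ ≤ 1 := hF.norm_snd_sub_one_lt.le
  have hq0 : 0 ≤ max ‖u‖ ‖v‖ := le_max_of_le_left (norm_nonneg u)
  -- the bound at natural points
  have hnat : ∀ ab : ℕ × ℕ, ‖F (Prod.map (Nat.cast : ℕ → ℤ_[p]) (Nat.cast : ℕ → ℤ_[p]) ab) -
      boxSum 𝕜 u v N (Prod.map (Nat.cast : ℕ → ℤ_[p]) (Nat.cast : ℕ → ℤ_[p]) ab)‖ ≤ (max ‖u‖ ‖v‖) ^ N := by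
    rintro ⟨a, b⟩
    simp only [Prod.map_apply]
    rw [hF.apply_natCast, boxSum_natCast]
    set A := ∑ i ∈ Finset.range N, ((a.choose i : ℕ) : 𝕜) * u ^ i with hA
    set B := ∑ j ∈ Finset.range N, ((b.choose j : ℕ) : 𝕜) * v ^ j with hB
    have hFu : F (1, 0) = 1 + u := by rw [hu]; ring
    have hFv : F (0, 1) = 1 + v := by rw [hv]; ring
    rw [hFu, hFv]
    have hsplit : (1 + u) ^ a * (1 + v) ^ b - A * B =
        ((1 + u) ^ a - A) * (1 + v) ^ b + A * ((1 + v) ^ b - B) := by ring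
    rw [hsplit]
    have h1 : ‖((1 + u) ^ a - A) * (1 + v) ^ b‖ ≤ (max ‖u‖ ‖v‖) ^ N := by
      rw [norm_mul]
      calc ‖(1 + u) ^ a - A‖ * ‖(1 + v) ^ b‖ ≤ ‖u‖ ^ N * 1 :=
            mul_le_mul (norm_one_add_pow_sub_sum_range_le hu1 a N) (norm_one_add_pow_le_one hv1 b)
              (norm_nonneg _) (pow_nonneg (norm_nonneg u) N)
        _ ≤ (max ‖u‖ ‖v‖) ^ N := by
            rw [mul_one]; exact pow_le_pow_left₀ (norm_nonneg u) (le_max_left _ _) N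
    have h2 : ‖A * ((1 + v) ^ b - B)‖ ≤ (max ‖u‖ ‖v‖) ^ N := by
      rw [norm_mul]
      calc ‖A‖ * ‖(1 + v) ^ b - B‖ ≤ 1 * ‖v‖ ^ N :=
            mul_le_mul (norm_sum_range_choose_mul_pow_le_one hu1 a N)
              (norm_one_add_pow_sub_sum_range_le hv1 b N) (norm_nonneg _) zero_le_one
        _ ≤ (max ‖u‖ ‖v‖) ^ N := by
            rw [one_mul]; exact pow_le_pow_left₀ (norm_nonneg v) (le_max_right _ _) N
    exact (IsUltrametricDist.norm_add_le_max _ _).trans (max_le h1 h2)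
  -- extend by density of `ℕ²` and continuity
  have hdense : DenseRange (Prod.map (Nat.cast : ℕ → ℤ_[p]) (Nat.cast : ℕ → ℤ_[p])) :=
    PadicInt.denseRange_natCast.prodMap PadicInt.denseRange_natCast
  have hclosed : IsClosed {w : ℤ_[p] × ℤ_[p] | ‖F w - boxSum 𝕜 u v N w‖ ≤ (max ‖u‖ ‖v‖) ^ N} :=
    isClosed_le ((hF.continuous.sub (continuous_boxSum u v N)).norm) continuous_const
  exact hdense.induction_on z hclosed hnat

end Character

/-! ### §3. The nested two-variable Amice transform and the character evaluation theorem -/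

namespace BoundedDistribution

variable {𝕜 : Type*} [NormedField 𝕜] [NormedAlgebra ℚ_[p] 𝕜]
variable (D : BoundedDistribution (padicIntSq p) 𝕜)

/-- **The nested two-variable Amice transform** of a bounded `𝕜`-valued distribution `μ` on
`ℤ_p × ℤ_p`: `𝓐_μ = Σ_{i,j} (∫ (x choose i)(y choose j) dμ) T₁^i T₂^j ∈ 𝕜⟦T₂⟧⟦T₁⟧`
(`PowerSeries (PowerSeries 𝕜)`, OUTER variable `T₁` ↔ first coordinate `x`, inner `T₂` ↔ `y`) —
"`∫ (1+T₁)^x (1+T₂)^y dμ(x, y)`", de Shalit's `G(χ; T₁, T₂)` for `μ` the push-forward of `χ⁻¹μ(𝔣)` to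
`Gal(K_∞K'_∞/K) ≅ ℤ_p²`. [cite: deShalit1987, II.4.17 (53)–(54) (p. 77–78)] -/
def amice₂ : PowerSeries (PowerSeries 𝕜) :=
  PowerSeries.mk fun i ↦ PowerSeries.mk fun j ↦ D.integral (mahlerFun₂ 𝕜 i j)

/-- **The coefficients of the transform are the integrals of the binomial functions**:
`[T₂^j]([T₁^i] 𝓐_μ) = ∫ (x choose i)(y choose j) dμ`. [cite: deShalit1987, II.4.17 (53) (p. 77)] -/
@[simp] theorem coeff_coeff_amice₂ (i j : ℕ) :
    PowerSeries.coeff j (PowerSeries.coeff i D.amice₂) = D.integral (mahlerFun₂ 𝕜 i j) := by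
  rw [amice₂, PowerSeries.coeff_mk, PowerSeries.coeff_mk]

/-- **The value at the trivial character is the total mass**: `[T⁰]𝓐_μ = ∫ 1 dμ = μ(ℤ_p²)`.
[cite: deShalit1987, II.4.17 (53) (p. 77)] -/
theorem constantCoeff_constantCoeff_amice₂ :
    PowerSeries.constantCoeff (PowerSeries.constantCoeff D.amice₂) = D.integral fun _ ↦ (1 : 𝕜) := by
  rw [← PowerSeries.coeff_zero_eq_constantCoeff_apply, ← PowerSeries.coeff_zero_eq_constantCoeff_apply,
    coeff_coeff_amice₂]
  congr 1
  funext z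
  rw [mahlerFun₂_apply]
  simp [mahler_apply]

variable [IsUltrametricDist 𝕜] [CompleteSpace 𝕜]

/-- The coefficients of the transform are bounded by `‖μ‖`. [cite: deShalit1987, II.4.17 (53) (p. 77)] -/
theorem norm_coeff_coeff_amice₂_le (i j : ℕ) :
    ‖PowerSeries.coeff j (PowerSeries.coeff i D.amice₂)‖ ≤ D.bound := by
  rw [coeff_coeff_amice₂]
  have h := D.norm_integral_le (uniformContinuous_mahlerFun₂ i j) zero_le_one (norm_mahlerFun₂_le_one i j)
  rwa [mul_one] at h

/-- **The box partial sums of `𝓐_μ(u, v)` are the integrals of the box truncations**: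
`Σ_{i,j<N} [T₁^iT₂^j]𝓐_μ · u^i v^j = ∫ S_N(u, v) dμ`. [cite: deShalit1987, II.4.17 (53) (p. 77)] -/
theorem sum_coeff_coeff_amice₂_mul_eq_integral_boxSum (u v : 𝕜) (N : ℕ) :
    ∑ ij ∈ Finset.range N ×ˢ Finset.range N,
        PowerSeries.coeff ij.2 (PowerSeries.coeff ij.1 D.amice₂) * u ^ ij.1 * v ^ ij.2 =
      D.integral (boxSum 𝕜 u v N) := by
  have h : boxSum 𝕜 u v N = fun z : ℤ_[p] × ℤ_[p] ↦ ∑ ij ∈ Finset.range N ×ˢ Finset.range N,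
      mahlerFun₂ 𝕜 ij.1 ij.2 z * (u ^ ij.1 * v ^ ij.2) := rfl
  rw [h, D.integral_finset_sum _ (fun ij _ ↦ uniformContinuous_mul_const (uniformContinuous_mahlerFun₂ ij.1 ij.2) _)]
  refine Finset.sum_congr rfl fun ij _ ↦ ?_
  rw [coeff_coeff_amice₂, D.integral_mul_const _ (uniformContinuous_mahlerFun₂ _ _), mul_assoc]

/-- **The defining family of `𝓐_μ(u, v)` is summable** on the open unit polydisc (comparison with the
double geometric series `‖μ‖ · ‖u‖^i ‖v‖^j` in the complete field `𝕜`).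
[cite: MazurTateTeitelbaum1986Invent, §I.13] -/
theorem summable_coeff_coeff_amice₂_mul {u v : 𝕜} (hu : ‖u‖ < 1) (hv : ‖v‖ < 1) :
    Summable fun k : ℕ × ℕ ↦
      PowerSeries.coeff k.2 (PowerSeries.coeff k.1 D.amice₂) * u ^ k.1 * v ^ k.2 := by
  have hgu : Summable fun i : ℕ ↦ D.bound * ‖u‖ ^ i :=
    (summable_geometric_of_lt_one (norm_nonneg u) hu).mul_left D.bound
  have hgv : Summable fun j : ℕ ↦ ‖v‖ ^ j := summable_geometric_of_lt_one (norm_nonneg v) hv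
  have hg : Summable fun k : ℕ × ℕ ↦ D.bound * ‖u‖ ^ k.1 * ‖v‖ ^ k.2 :=
    hgu.mul_of_nonneg hgv (fun i ↦ mul_nonneg D.bound_nonneg (pow_nonneg (norm_nonneg u) i))
      (fun j ↦ pow_nonneg (norm_nonneg v) j)
  refine Summable.of_norm_bounded hg fun k ↦ ?_
  rw [norm_mul, norm_mul, norm_pow, norm_pow]
  gcongr
  exact D.norm_coeff_coeff_amice₂_le k.1 k.2

/-- **The character evaluation theorem for the two-variable Amice transform.** For a bounded
distribution `μ` on `ℤ_p × ℤ_p` with values in a complete non-archimedean field `𝕜 ⊇ ℚ_p` and every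
continuous character `F : ℤ_p² → 𝕜` with principal-unit values `F(1,0) = 1 + u`, `F(0,1) = 1 + v`,

  `Σ_{(i,j) ∈ ℕ²} [T₁^iT₂^j]𝓐_μ · u^i v^j = ∫ F dμ`      (`HasSum` over `ℕ × ℕ`),

i.e. `𝓐_μ(F(1,0) − 1, F(0,1) − 1) = ∫ F dμ`: the value of the power series `G(χ; T₁, T₂)` at
`Tᵢ = χ(γᵢ) − 1` is the integral of the character `χ` — de Shalit's (52)–(53) "in two variables, left
to the reader" (II.4.17 (54)), for ARBITRARY continuous characters (values in ramified extensions of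
`ℚ_p` inside `ℂ_p` included). Proof: the box partial sums are `∫ S_N dμ`
(`sum_coeff_coeff_amice₂_mul_eq_integral_boxSum`), `‖F − S_N‖_∞ ≤ max(‖u‖,‖v‖)^N`
(`IsContinuousChar₂.norm_sub_boxSum_le`), so they tend to `∫ F dμ`; the family is summable
(`summable_coeff_coeff_amice₂_mul`) and its sum is the limit of the box partial sums.
[cite: deShalit1987, II.4.17 (52)–(54) (p. 77–78)] -/
theorem hasSum_amice₂_character {F : ℤ_[p] × ℤ_[p] → 𝕜} (hF : IsContinuousChar₂ F) :
    HasSum (fun k : ℕ × ℕ ↦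
      PowerSeries.coeff k.2 (PowerSeries.coeff k.1 D.amice₂) * (F (1, 0) - 1) ^ k.1 * (F (0, 1) - 1) ^ k.2)
      (D.integral F) := by
  set u := F (1, 0) - 1 with hu
  set v := F (0, 1) - 1 with hv
  have hsum := D.summable_coeff_coeff_amice₂_mul hF.norm_fst_sub_one_lt hF.norm_snd_sub_one_lt
  -- the box partial sums tend to the sum of the family …
  have hbox : Tendsto (fun N : ℕ ↦ ∑ ij ∈ Finset.range N ×ˢ Finset.range N,
      PowerSeries.coeff ij.2 (PowerSeries.coeff ij.1 D.amice₂) * u ^ ij.1 * v ^ ij.2) atTop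
      (𝓝 (∑' k : ℕ × ℕ, PowerSeries.coeff k.2 (PowerSeries.coeff k.1 D.amice₂) * u ^ k.1 * v ^ k.2)) :=
    hsum.hasSum.comp tendsto_range_product_range_atTop
  -- … and are the integrals of the box truncations, which tend to `∫ F dμ`
  have hbox' : Tendsto (fun N : ℕ ↦ D.integral (boxSum 𝕜 u v N)) atTop
      (𝓝 (∑' k : ℕ × ℕ, PowerSeries.coeff k.2 (PowerSeries.coeff k.1 D.amice₂) * u ^ k.1 * v ^ k.2)) :=
    hbox.congr fun N ↦ D.sum_coeff_coeff_amice₂_mul_eq_integral_boxSum u v N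
  have hq0 : 0 ≤ max ‖u‖ ‖v‖ := le_max_of_le_left (norm_nonneg u)
  have hq1 : max ‖u‖ ‖v‖ < 1 := max_lt hF.norm_fst_sub_one_lt hF.norm_snd_sub_one_lt
  have hint : Tendsto (fun N : ℕ ↦ D.integral (boxSum 𝕜 u v N)) atTop (𝓝 (D.integral F)) :=
    D.tendsto_integral_of_forall_norm_sub_le (fun N ↦ uniformContinuous_boxSum u v N)
      hF.uniformContinuous (fun N ↦ pow_nonneg hq0 N)
      (fun N z ↦ by rw [norm_sub_rev]; exact hF.norm_sub_boxSum_le N z)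
      (tendsto_pow_atTop_nhds_zero_of_lt_one hq0 hq1)
  have heq := tendsto_nhds_unique hbox' hint
  rw [← heq]
  exact hsum.hasSum

/-- The evaluation theorem read as an identity of sums: `∑' [T₁^iT₂^j]𝓐_μ u^i v^j = ∫ F dμ`.
[cite: deShalit1987, II.4.17 (52)–(54) (p. 77–78)] -/
theorem tsum_amice₂_character {F : ℤ_[p] × ℤ_[p] → 𝕜} (hF : IsContinuousChar₂ F) :
    ∑' k : ℕ × ℕ, PowerSeries.coeff k.2 (PowerSeries.coeff k.1 D.amice₂) *
        (F (1, 0) - 1) ^ k.1 * (F (0, 1) - 1) ^ k.2 = D.integral F :=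
  (D.hasSum_amice₂_character hF).tsum_eq

end BoundedDistribution

end Literature.NumberTheory.EllipticCurves

end
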